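/-
Origin: expansion seat `planner-pub-hodgecm-toy2-g2-0`, handover 2026-08-18 (`HOME/pub-hodgecm-toy2-g2/lean/Toy2g2/Closure.lean`, md5 e25e2cac, 140 lines);
landed by the gen-6 packager in gate run 22 as `HodgeCM/Model/SexticCM/Closure.lean` (import ^import Toy2g2\.→import HodgeCM.Model.SexticCM. ×1).
-/
/-
Copyright: pub-hodgecm formalisation cell (harness21, 2026). New file (not vendored).
Origin: HOME/pub-hodgecm-toy2-g2/lean/Toy2g2/Closure.lean (WIP module `Toy2g2.Closure`; intended final place
`HodgeCM/Model/SexticCM/Closure.lean` = module `HodgeCM.Model.SexticCM.Closure`, CONTRIBUTING §3 L5) (seat planner-pub-hodgecm-toy2-g2-0,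
consistency seat 2 gen 2, part (6a)(ii): PerL's hypotheses are inhabited — E = Q(rootSet m_kappa) subset C: splitting field, Galois, CM, IsNormalClosure Q K E).
-/
import Summits.HodgeConjecture.HodgeCM.Model.SexticCM.SexticField

/-!
# The normal closure `E = ℚ(±δ₀, ±δ₁, ±δ₂)` of `K` inside `ℂ`
-/

open Polynomial IntermediateField NumberField

noncomputable section

namespace HodgeCM.SexticCM

/-- The normal closure of `K`: the splitting field of `m_κ` inside `ℂ`. -/
def E : IntermediateField ℚ ℂ := adjoin ℚ (mκ.rootSet ℂ)

/-- (Ported verbatim from the HodgeCMPerL package; no docstring in the source.) -/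
instance instIsSplittingFieldE : mκ.IsSplittingField ℚ E :=
  adjoin_rootSet_isSplittingField (IsAlgClosed.splits _)

/-- (Ported verbatim from the HodgeCMPerL package; no docstring in the source.) -/
instance instNormalE : Normal ℚ E := Normal.of_isSplittingField mκ

/-- (Ported verbatim from the HodgeCMPerL package; no docstring in the source.) -/
instance instFiniteDimensionalE : FiniteDimensional ℚ E := IsSplittingField.finiteDimensional E mκ

/-- (Ported verbatim from the HodgeCMPerL package; no docstring in the source.) -/
instance instNumberFieldE : NumberField E := NumberField.of_module_finite ℚ E

/-- (Ported verbatim from the HodgeCMPerL package; no docstring in the source.) -/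
instance instIsGaloisE : IsGalois ℚ E := IsGalois.of_separable_splitting_field mκ_separable

/-- (Ported verbatim from the HodgeCMPerL package; no docstring in the source.) -/
lemma δ_mem_rootSet (k : Fin 3) : δ k ∈ mκ.rootSet ℂ := (mem_rootSet_iff _).mpr ⟨k, .inl rfl⟩

/-- (Ported verbatim from the HodgeCMPerL package; no docstring in the source.) -/
lemma neg_δ_mem_rootSet (k : Fin 3) : -δ k ∈ mκ.rootSet ℂ := (mem_rootSet_iff _).mpr ⟨k, .inr rfl⟩

/-- (Ported verbatim from the HodgeCMPerL package; no docstring in the source.) -/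
lemma δ_mem_E (k : Fin 3) : δ k ∈ E := subset_adjoin ℚ _ (δ_mem_rootSet k)

/-- (Ported verbatim from the HodgeCMPerL package; no docstring in the source.) -/
lemma K_le_E : K ≤ E := adjoin_simple_le_iff.mpr (δ_mem_E 0)

/-- (Ported verbatim from the HodgeCMPerL package; no docstring in the source.) -/
instance algKE : Algebra K E := (IntermediateField.inclusion K_le_E).toRingHom.toAlgebra

/-- (Ported verbatim from the HodgeCMPerL package; no docstring in the source.) -/
instance istKE : IsScalarTower ℚ K E := IsScalarTower.of_algebraMap_eq fun _ => rfl

/-- (Ported verbatim from the HodgeCMPerL package; no docstring in the source.) -/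
instance instIsTotallyComplexE : IsTotallyComplex E := isTotallyComplex_of_algebra K E

/-- conjugation negates every root of `m_κ` -/
lemma conj_root {r : ℂ} (hr : r ∈ mκ.rootSet ℂ) : (starRingEnd ℂ) r = -r := by
  obtain ⟨k, rfl | rfl⟩ := (mem_rootSet_iff r).mp hr
  · exact conj_δ k
  · rw [map_neg, conj_δ]

/-- (Ported verbatim from the HodgeCMPerL package; no docstring in the source.) -/
lemma neg_root_mem {r : ℂ} (hr : r ∈ mκ.rootSet ℂ) : -r ∈ mκ.rootSet ℂ := by
  obtain ⟨k, rfl | rfl⟩ := (mem_rootSet_iff r).mp hr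
  · exact neg_δ_mem_rootSet k
  · rw [neg_neg]; exact δ_mem_rootSet k

/-- complex conjugation as a `ℚ`-algebra hom of `ℂ` -/
def conjQ : ℂ →ₐ[ℚ] ℂ := (starRingEnd ℂ).toRatAlgHom

/-- (Ported verbatim from the HodgeCMPerL package; no docstring in the source.) -/
@[simp] lemma conjQ_apply (z : ℂ) : conjQ z = (starRingEnd ℂ) z := rfl

/-- (Ported verbatim from the HodgeCMPerL package; no docstring in the source.) -/
lemma conj_mem_E {x : ℂ} (hx : x ∈ E) : (starRingEnd ℂ) x ∈ E := by
  have h1 : conjQ x ∈ E.map conjQ := ⟨x, hx, rfl⟩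
  rw [E, adjoin_map] at h1
  have h2 : conjQ '' (mκ.rootSet ℂ) ⊆ mκ.rootSet ℂ := by
    rintro _ ⟨r, hr, rfl⟩
    rw [conjQ_apply, conj_root hr]
    exact neg_root_mem hr
  exact adjoin.mono ℚ _ _ h2 h1

/-- complex conjugation restricted to `E` -/
def σE : E →ₐ[ℚ] E where
  toFun x := ⟨(starRingEnd ℂ) x, conj_mem_E x.2⟩
  map_one' := by ext; simp
  map_mul' x y := by ext; simp
  map_zero' := by ext; simp
  map_add' x y := by ext; simp
  commutes' q := by ext; simp

/-- (Ported verbatim from the HodgeCMPerL package; no docstring in the source.) -/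
@[simp] lemma coe_σE (x : E) : ((σE x : E) : ℂ) = (starRingEnd ℂ) x := rfl

/-- (Ported verbatim from the HodgeCMPerL package; no docstring in the source.) -/
lemma σE_σE (x : E) : σE (σE x) = x := by ext; simp

/-- complex conjugation as an element of `Gal(E/ℚ)` -/
def σ : E ≃ₐ[ℚ] E := AlgEquiv.ofBijective σE
  ⟨fun x y h => by simpa [σE_σE] using congrArg σE h, fun y => ⟨σE y, σE_σE y⟩⟩

/-- (Ported verbatim from the HodgeCMPerL package; no docstring in the source.) -/
@[simp] lemma coe_σ (x : E) : ((σ x : E) : ℂ) = (starRingEnd ℂ) x := rfl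

/-- an embedding of `E` maps roots of `m_κ` to roots of `m_κ` -/
lemma emb_root (φ : E →+* ℂ) {r : ℂ} (hr : r ∈ mκ.rootSet ℂ) (hrE : r ∈ E) :
    φ ⟨r, hrE⟩ ∈ mκ.rootSet ℂ := by
  rw [mem_rootSet_of_ne mκ_ne_zero]
  have h0 : aeval (⟨r, hrE⟩ : E) mκ = 0 := by
    apply (algebraMap E ℂ).injective
    rw [← aeval_algebraMap_apply, map_zero]
    exact (mem_rootSet_of_ne mκ_ne_zero).mp hr
  have := congrArg φ.toRatAlgHom h0
  rwa [← aeval_algHom_apply, map_zero] at this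

/-- Every embedding of `E` intertwines `σ` with complex conjugation. -/
lemma isConj_σ (φ : E →+* ℂ) : ComplexEmbedding.IsConj φ σ := by
  unfold ComplexEmbedding.IsConj
  suffices h : (ComplexEmbedding.conjugate φ).toRatAlgHom = (φ.comp (σ : E →+* E)).toRatAlgHom by
    have := congrArg AlgHom.toRingHom h
    simpa using this
  apply adjoin_algHom_ext ℚ
  intro r hr
  change (starRingEnd ℂ) (φ ⟨r, _⟩) = φ (σ ⟨r, _⟩)
  have hσr : σ ⟨r, subset_adjoin ℚ _ hr⟩ = -⟨r, subset_adjoin ℚ _ hr⟩ := by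
    ext; simp [conj_root hr]
  rw [hσr, map_neg, conj_root (emb_root φ hr _)]

/-- (Ported verbatim from the HodgeCMPerL package; no docstring in the source.) -/
instance instIsCMFieldE : IsCMField E := IsCMField.of_forall_isConj E isConj_σ

/-! ### `E` is a normal closure of `K` -/

/-- (Ported verbatim from the HodgeCMPerL package; no docstring in the source.) -/
lemma minpoly_δ0K : minpoly ℚ δ0K = mκ :=
  (minpoly_gen ℚ (δ 0)).trans minpoly_δ0

/-- (Ported verbatim from the HodgeCMPerL package; no docstring in the source.) -/
lemma adjoin_rootSet_E_eq_top : adjoin ℚ (mκ.rootSet E) = ⊤ :=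
  adjoin_eq_top_of_algebra ℚ _ (IsSplittingField.adjoin_rootSet E mκ)

/-- (Ported verbatim from the HodgeCMPerL package; no docstring in the source.) -/
instance instIsNormalClosure : IsNormalClosure ℚ K E where
  splits x := by
    have h := Normal.splits instNormalE (algebraMap K E x)
    rwa [minpoly.algebraMap_eq (algebraMap K E).injective] at h
  adjoin_rootSet := by
    rw [eq_top_iff, ← adjoin_rootSet_E_eq_top, ← minpoly_δ0K]
    exact le_iSup (fun x : K => adjoin ℚ ((minpoly ℚ x).rootSet E)) δ0K

/-- the inclusion `j : K → E` and `ι₁ : E → ℂ` -/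
def jKE : K →+* E := algebraMap K E

/-- (Ported verbatim from the HodgeCMPerL package; no docstring in the source.) -/
def ιE : E →+* ℂ := algebraMap E ℂ

/-- (Ported verbatim from the HodgeCMPerL package; no docstring in the source.) -/
lemma ιE_comp_jKE : ιE.comp jKE = algebraMap K ℂ := rfl

end HodgeCM.SexticCM
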